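import Mathlib
import Summits.ResolutionOfSingularities.ResolutionOfSingularities.Theorems.ShadowGameShadowGameWinRStubInitialForm

/-!
# `ShadowGameWinR` (crux stmt-ResolutionOfSingularities-18182, route `ShadowGame`), negative side —
# part 3a: weighted initial forms (toolkit over `stub_initialForm`)

`IsInit wt ι` packages the output of `stub_initialForm` (lowest weighted-homogeneous part as a polynomial,
multiplicative); consequences: `ι 1 = 1`, powers/products, `ι (X i)`, `ι unit = C`, `ι ↑P = P` for a
weighted-homogeneous polynomial, `ι (f − g)` without cancellation, and the WEIGHT BOUND under divisibility
`ψ ∣ η ⇒ wt ψ ≤ wt η` (the engine of the certificate).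
Lead prover-line-stmt-ResolutionOfSingularities-18182-0, 2026-08-17.
-/

noncomputable section

set_option linter.dupNamespace false

namespace Summit.ResolutionOfSingularities.ResolutionOfSingularities.Theorems.ShadowGameWinR.Negative

open MvPowerSeries

variable {κ : Type} [Field κ]

section InitialForm

variable {wt : Fin 3 → ℕ} {ι : MvPowerSeries (Fin 3) κ → MvPolynomial (Fin 3) κ}

/-- The package of properties delivered by `stub_initialForm`. [folklore] -/
structure IsInit (wt : Fin 3 → ℕ) (ι : MvPowerSeries (Fin 3) κ → MvPolynomial (Fin 3) κ) : Prop where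
  zero_iff : ∀ f, ι f = 0 ↔ f = 0
  mul : ∀ f g, ι (f * g) = ι f * ι g
  coeff : ∀ f : MvPowerSeries (Fin 3) κ, f ≠ 0 → ∃ N : ℕ,
    (∀ d, Finsupp.weight wt d < N → MvPowerSeries.coeff d f = 0) ∧
    (∃ d, Finsupp.weight wt d = N ∧ MvPowerSeries.coeff d f ≠ 0) ∧
    (∀ d, MvPolynomial.coeff d (ι f) = if Finsupp.weight wt d = N then MvPowerSeries.coeff d f else 0)

/-- `stub_initialForm` repackaged. [folklore] -/
theorem exists_isInit (wt : Fin 3 → ℕ) (hwt : ∀ i, 0 < wt i) :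
    ∃ ι : MvPowerSeries (Fin 3) κ → MvPolynomial (Fin 3) κ, IsInit wt ι := by
  obtain ⟨ι, h1, h2, h3⟩ := stub_initialForm κ wt hwt
  exact ⟨ι, ⟨h1, h2, h3⟩⟩

/-- The weight level `N` of a non-zero series is unique: it is pinned by "vanishing below, present at". [folklore] -/
theorem level_unique {f : MvPowerSeries (Fin 3) κ} {N N' : ℕ}
    (h1 : ∀ d, Finsupp.weight wt d < N → MvPowerSeries.coeff d f = 0)
    (h2 : ∃ d, Finsupp.weight wt d = N ∧ MvPowerSeries.coeff d f ≠ 0)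
    (h1' : ∀ d, Finsupp.weight wt d < N' → MvPowerSeries.coeff d f = 0)
    (h2' : ∃ d, Finsupp.weight wt d = N' ∧ MvPowerSeries.coeff d f ≠ 0) : N = N' := by
  obtain ⟨d, hd, hdf⟩ := h2
  obtain ⟨d', hd', hdf'⟩ := h2'
  by_contra hne
  rcases Nat.lt_or_gt_of_ne hne with h | h
  · exact hdf (h1' d (hd ▸ h))
  · exact hdf' (h1 d' (hd' ▸ h))

/-- Coefficients of `ι f` from explicit lowest-weight data. [folklore] -/
theorem IsInit.coeff_of_level (hι : IsInit wt ι) {f : MvPowerSeries (Fin 3) κ} {N : ℕ}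
    (h1 : ∀ d, Finsupp.weight wt d < N → MvPowerSeries.coeff d f = 0)
    (h2 : ∃ d, Finsupp.weight wt d = N ∧ MvPowerSeries.coeff d f ≠ 0) :
    ∀ d, MvPolynomial.coeff d (ι f) = if Finsupp.weight wt d = N then MvPowerSeries.coeff d f else 0 := by
  have hf : f ≠ 0 := by
    obtain ⟨d, -, hdf⟩ := h2
    intro hf; exact hdf (by rw [hf]; simp)
  obtain ⟨N', h1', h2', h3'⟩ := hι.coeff f hf
  rw [level_unique h1 h2 h1' h2']
  exact h3'

/-- The level of `ι f` read off from a non-zero coefficient of `ι f`. [folklore] -/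
theorem IsInit.level_of_coeff_ne (hι : IsInit wt ι) {f : MvPowerSeries (Fin 3) κ} (hf : f ≠ 0)
    {d : Fin 3 →₀ ℕ} (hd : MvPolynomial.coeff d (ι f) ≠ 0) :
    (∀ d', Finsupp.weight wt d' < Finsupp.weight wt d → MvPowerSeries.coeff d' f = 0) ∧
    (∃ d', Finsupp.weight wt d' = Finsupp.weight wt d ∧ MvPowerSeries.coeff d' f ≠ 0) := by
  obtain ⟨N, h1, h2, h3⟩ := hι.coeff f hf
  have hN : Finsupp.weight wt d = N := by
    have := h3 d
    by_contra hne
    rw [if_neg hne] at this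
    exact hd this
  rw [hN]
  exact ⟨h1, h2⟩

/-- Every coefficient of `ι f` is the corresponding coefficient of `f` or zero. [folklore] -/
theorem IsInit.coeff_eq_or (hι : IsInit wt ι) (f : MvPowerSeries (Fin 3) κ) (d : Fin 3 →₀ ℕ) :
    MvPolynomial.coeff d (ι f) = MvPowerSeries.coeff d f ∨ MvPolynomial.coeff d (ι f) = 0 := by
  by_cases hf : f = 0
  · right; rw [(hι.zero_iff f).mpr hf]; simp
  obtain ⟨N, -, -, h3⟩ := hι.coeff f hf
  rw [h3 d]; split_ifs <;> simp

/-- `ι 1 = 1`. [folklore] -/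
theorem IsInit.one (hι : IsInit wt ι) : ι (1 : MvPowerSeries (Fin 3) κ) = 1 := by
  have h : ι 1 * ι 1 = ι 1 := by rw [← hι.mul, one_mul]
  have h0 : ι (1 : MvPowerSeries (Fin 3) κ) ≠ 0 := fun h0 => one_ne_zero ((hι.zero_iff 1).mp h0)
  exact (mul_eq_left₀ h0).mp h

/-- `ι` of a power. [folklore] -/
theorem IsInit.pow (hι : IsInit wt ι) (f : MvPowerSeries (Fin 3) κ) (n : ℕ) : ι (f ^ n) = ι f ^ n := by
  induction n with
  | zero => rw [pow_zero, pow_zero, hι.one]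
  | succ n ih => rw [pow_succ, hι.mul, ih, pow_succ]

/-- `ι` of a finite product. [folklore] -/
theorem IsInit.prod (hι : IsInit wt ι) {α : Type} (s : Finset α) (f : α → MvPowerSeries (Fin 3) κ) :
    ι (s.prod f) = s.prod (fun a => ι (f a)) := by
  classical
  induction s using Finset.induction_on with
  | empty => simp [hι.one]
  | insert a s ha ih => rw [Finset.prod_insert ha, Finset.prod_insert ha, hι.mul, ih]

/-- `ι f ≠ 0` for `f ≠ 0`. [folklore] -/
theorem IsInit.ne_zero (hι : IsInit wt ι) {f : MvPowerSeries (Fin 3) κ} (hf : f ≠ 0) : ι f ≠ 0 :=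
  fun h => hf ((hι.zero_iff f).mp h)

/-- The weight of an exponent, as a sum over `Fin 3`. [folklore] -/
theorem weight_eq_sum (wt : Fin 3 → ℕ) (d : Fin 3 →₀ ℕ) :
    Finsupp.weight wt d = ∑ i, d i * wt i := by
  rw [Finsupp.weight_apply, Finsupp.sum_fintype]
  · rfl
  · intro i; simp

/-- A single coordinate bounds the weight from below. [folklore] -/
theorem mul_le_weight (wt : Fin 3 → ℕ) (d : Fin 3 →₀ ℕ) (i : Fin 3) :
    d i * wt i ≤ Finsupp.weight wt d := by
  rw [weight_eq_sum]
  exact Finset.single_le_sum (f := fun j => d j * wt j) (fun j _ => Nat.zero_le _) (Finset.mem_univ i)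

/-- With positive weights, weight `0` forces the zero exponent. [folklore] -/
theorem eq_zero_of_weight_eq_zero {wt : Fin 3 → ℕ} (hwt : ∀ i, 0 < wt i) {d : Fin 3 →₀ ℕ}
    (h : Finsupp.weight wt d = 0) : d = 0 := by
  ext i
  have := mul_le_weight wt d i
  rw [h] at this
  have hi := hwt i
  simp only [Finsupp.coe_zero, Pi.zero_apply]
  nlinarith

/-- `ι (X i) = X i`. [folklore] -/
theorem IsInit.of_X (hι : IsInit wt ι) (i : Fin 3) :
    ι (X i) = MvPolynomial.X i := by
  classical
  have key := hι.coeff_of_level (f := X i) (N := wt i)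
    (fun d hd => by
      rw [MvPowerSeries.coeff_X]
      split_ifs with h
      · subst h; simp [Finsupp.weight_single] at hd
      · rfl)
    ⟨Finsupp.single i 1, by simp [Finsupp.weight_single], by
      rw [MvPowerSeries.coeff_index_single_self_X]; exact one_ne_zero⟩
  ext d
  rw [key d, MvPolynomial.coeff_X, MvPowerSeries.coeff_X]
  by_cases h : d = Finsupp.single i 1
  · subst h; simp [Finsupp.weight_single]
  · rw [if_neg h, if_neg (Ne.symm h)]; split_ifs <;> rfl

/-- `ι` of a unit is the constant `C u(0)`. [folklore] -/
theorem IsInit.of_unit (hι : IsInit wt ι) (hwt : ∀ i, 0 < wt i) {u : MvPowerSeries (Fin 3) κ}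
    (hu : MvPowerSeries.constantCoeff u ≠ 0) : ι u = MvPolynomial.C (MvPowerSeries.constantCoeff u) := by
  classical
  have key := hι.coeff_of_level (f := u) (N := 0) (fun d hd => absurd hd (Nat.not_lt_zero _))
    ⟨0, by simp, by rwa [MvPowerSeries.coeff_zero_eq_constantCoeff_apply]⟩
  ext d
  rw [key d, MvPolynomial.coeff_C]
  by_cases h : d = 0
  · subst h; simp
  · have : Finsupp.weight wt d ≠ 0 := fun h0 => h (eq_zero_of_weight_eq_zero hwt h0)
    rw [if_neg this, if_neg (Ne.symm h)]

/-- A polynomial all of whose monomials have one weight is its own initial form. [folklore] -/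
theorem IsInit.of_coe (hι : IsInit wt ι) {P : MvPolynomial (Fin 3) κ} (hP : P ≠ 0) {N : ℕ}
    (hN : ∀ d, MvPolynomial.coeff d P ≠ 0 → Finsupp.weight wt d = N) :
    ι (P : MvPowerSeries (Fin 3) κ) = P := by
  have key := hι.coeff_of_level (f := (P : MvPowerSeries (Fin 3) κ)) (N := N)
    (fun d hd => by
      rw [MvPolynomial.coeff_coe]
      by_contra h
      exact absurd (hN d h) (ne_of_lt hd))
    (by
      obtain ⟨d, hd⟩ := MvPolynomial.ne_zero_iff.mp hP
      exact ⟨d, hN d hd, by rwa [MvPolynomial.coeff_coe]⟩)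
  ext d
  rw [key d, MvPolynomial.coeff_coe]
  split_ifs with h
  · rfl
  · by_contra hne
    exact h (hN d (Ne.symm hne))

/-- `ι` of a difference whose initial forms do not cancel. [folklore] -/
theorem IsInit.of_sub (hι : IsInit wt ι) {f g : MvPowerSeries (Fin 3) κ} {N : ℕ}
    (hf1 : ∀ d, Finsupp.weight wt d < N → MvPowerSeries.coeff d f = 0)
    (hf2 : ∃ d, Finsupp.weight wt d = N ∧ MvPowerSeries.coeff d f ≠ 0)
    (hg1 : ∀ d, Finsupp.weight wt d < N → MvPowerSeries.coeff d g = 0)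
    (hg2 : ∃ d, Finsupp.weight wt d = N ∧ MvPowerSeries.coeff d g ≠ 0)
    (hne : ι f - ι g ≠ 0) : ι (f - g) = ι f - ι g := by
  have kf := hι.coeff_of_level hf1 hf2
  have kg := hι.coeff_of_level hg1 hg2
  have h1 : ∀ d, Finsupp.weight wt d < N → MvPowerSeries.coeff d (f - g) = 0 := fun d hd => by
    rw [map_sub, hf1 d hd, hg1 d hd, sub_zero]
  have h2 : ∃ d, Finsupp.weight wt d = N ∧ MvPowerSeries.coeff d (f - g) ≠ 0 := by
    obtain ⟨d, hd⟩ := MvPolynomial.ne_zero_iff.mp hne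
    rw [MvPolynomial.coeff_sub, kf d, kg d] at hd
    by_cases h : Finsupp.weight wt d = N
    · rw [if_pos h, if_pos h] at hd
      exact ⟨d, h, by rwa [map_sub]⟩
    · rw [if_neg h, if_neg h, sub_zero] at hd; exact absurd rfl hd
  ext d
  rw [hι.coeff_of_level h1 h2 d, MvPolynomial.coeff_sub, kf d, kg d, map_sub]
  split_ifs <;> simp

/-- Weight bound under divisibility: if `ψ ∣ η ≠ 0`, `ψ` is supported in weight `dψ` and `η` in weight `N`,
then `dψ ≤ N`. [folklore] -/
theorem IsInit.weight_le_of_dvd (hι : IsInit wt ι) {ψ η : MvPolynomial (Fin 3) κ} (hη : η ≠ 0)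
    {dψ N : ℕ} (hψ : ∀ d, MvPolynomial.coeff d ψ ≠ 0 → Finsupp.weight wt d = dψ)
    (hN : ∀ d, MvPolynomial.coeff d η ≠ 0 → Finsupp.weight wt d = N) (hdvd : ψ ∣ η) : dψ ≤ N := by
  classical
  obtain ⟨ρ, rfl⟩ := hdvd
  have hψ0 : ψ ≠ 0 := left_ne_zero_of_mul hη
  have hρ0 : ρ ≠ 0 := right_ne_zero_of_mul hη
  -- pass to power series and take initial forms
  have hcoe : ι ((ψ : MvPowerSeries (Fin 3) κ) * (ρ : MvPowerSeries (Fin 3) κ)) = ψ * ι (ρ : MvPowerSeries (Fin 3) κ) := by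
    rw [hι.mul, hι.of_coe hψ0 hψ]
  rw [← MvPolynomial.coe_mul, hι.of_coe hη hN] at hcoe
  -- a non-zero coefficient of η = ψ * ι ρ comes from weight dψ + (level of ρ)
  have hρc : (ρ : MvPowerSeries (Fin 3) κ) ≠ 0 := by
    intro h; exact hρ0 (MvPolynomial.coe_eq_zero_iff.mp h)
  obtain ⟨Nρ, -, -, h3⟩ := hι.coeff (ρ : MvPowerSeries (Fin 3) κ) hρc
  obtain ⟨d, hd⟩ := MvPolynomial.ne_zero_iff.mp hη
  have hdN := hN d hd
  rw [hcoe, MvPolynomial.coeff_mul] at hd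
  obtain ⟨⟨a, b⟩, hab, hne⟩ := Finset.exists_ne_zero_of_sum_ne_zero hd
  rw [Finset.HasAntidiagonal.mem_antidiagonal] at hab
  have ha : MvPolynomial.coeff a ψ ≠ 0 := left_ne_zero_of_mul hne
  have hb : MvPolynomial.coeff b (ι (ρ : MvPowerSeries (Fin 3) κ)) ≠ 0 := right_ne_zero_of_mul hne
  have hbw : Finsupp.weight wt b = Nρ := by
    have := h3 b; by_contra hh; rw [if_neg hh] at this; exact hb this
  have : Finsupp.weight wt d = dψ + Nρ := by rw [← hab, map_add, hψ a ha, hbw]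
  omega

end InitialForm

end Summit.ResolutionOfSingularities.ResolutionOfSingularities.Theorems.ShadowGameWinR.Negative

end
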